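import Literature.MathematicalPhysics.QuantumLattice.StructureFactorSumRuleFloor
import Literature.Probability.LatticeModels.CycleMomentumEstimates
import HarnessLib

/-!
# The Fejér box identity for the pair structure factor: box averages of the translation-averaged pair
# correlation versus the torus diagonal (window tightness form of the torus passage)

Topic `Literature/MathematicalPhysics/QuantumLattice`; namespace = path. Companion of `PairFieldMomentum.lean`
(`pairStructureFactor g L ψ m = ‖Δ_g(m)ψ‖²/L²`, Kennedy–Lieb–Shastry normalisation; `momentumNormSq`) and
`StructureFactorSumRuleFloor.lean` (the dictionary sum rule
`Σ_m Re χ_m(z) · S_ψ(m) = Re Σ_x ⟨P_x ψ, P_{x+z} ψ⟩`, `sum_re_torusChar_mul_pairStructureFactor`). For EVERY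
vector `ψ` on the fermionic `L × L` torus (no translation invariance, no Hamiltonian), with
`C̄_L(z) := L⁻² Re Σ_x ⟨P_x ψ, P_{x+z} ψ⟩` (`siteAvgPairCorr`, the translation-AVERAGED pair correlation),
the Fejér box weight `F_n(m) := n⁻⁴ |Σ_{u ∈ [0,n)²} χ_m(ū)|²` (`fejerBoxWeight`) and the box average
`b_{L,n}(ψ) := n⁻⁴ Σ_{u,v ∈ [0,n)²} C̄_L(v̄ − ū)` (`boxAvgPairCorr`):

* (F1) `boxAvgPairCorr_eq_sum_fejerBoxWeight_mul` — **`b_{L,n}(ψ) = L⁻² Σ_m F_n(m) · S_ψ(m)`** (`n ≥ 1`), the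
  lattice Fejér identity `Σ_{u,v} χ_m(v̄ − ū) = |Σ_u χ_m(ū)|²`;
* `fejerBoxWeight_zero` (`F_n(0) = 1`), `fejerBoxWeight_nonneg`, `fejerBoxWeight_le_one`;
* (F2) `torusDiagonal_le_boxAvgPairCorr` — the torus DIAGONAL `s_L(ψ) := S_ψ(0)/L² = L⁻⁴ Re⟨ψ, Δ_g†Δ_g ψ⟩`
  (`torusDiagonal`; the pair long-range-order functional of the Hubbard summit statement at side `L`) is
  `≤ b_{L,n}(ψ)` for every `n ≥ 1` — Bochner positivity; the Cauchy–Schwarz form of the same inequality is the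
  tree's `pairFieldDensity_le_box_avgPairCorr_shape` (`PairFieldBoxAverageBound.lean`);
* (F3) `boxAvgPairCorr_sub_windowTail_sub_le_torusDiagonal` —
  `s_L ≥ b_{L,n} − T_ε(ψ)/L² − (2π²/(nε)²) · (Σ_m S_ψ(m))/L²`, `T_ε(ψ)/L² = windowTail` the small-momentum
  window functional `L⁻² Σ_{m ≠ 0, |q_m|² ≤ ε²} S_ψ(m)` and `Σ_m S_ψ(m)/L²` the local pair density
  (`sum_pairStructureFactor`), from the Fejér leakage bound `fejerBoxWeight_le_of_lt_momentumNormSq`: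
  `F_n(m) ≤ 2π²/(nε)²` once `|q_m|² > ε²` (one coordinate has `q_i² > ε²/2`, and the one-dimensional
  geometric sum obeys `|Σ_{k<n} e^{iq k}|² ≤ 2/(1 − cos q) ≤ π²/q²`, the tree's
  `eight_mul_sq_div_sq_le_one_sub_cos`).

READING (Hubbard cuprate cell `hubbard-cq`, transplant lens, DICTIONARY §13; route `KacWindowPenalty` crux
`WindowInfraredBound`): along a torus-limit sequence the box averages `b_{L,n}` converge to the box pair
long-range order of the limit state, so (F2)/(F3) say that the torus diagonal of the summit statement and the
box long-range order of torus limits differ EXACTLY by the small-momentum window tail — "BN7 = window tightness".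
Everything here is finite-volume and PROVED; the five `def`s are bookkeeping names for the quantities above;
no number, no claim about any Hamiltonian.

## References
* L. Grafakos, *Classical Fourier Analysis* (2008), Prop. 3.1.7 and eqs. (3.1.15)–(3.1.18) (the Fejér kernel
  as the normalised square of the Dirichlet sum; separable multi-dimensional version). [cite: Grafakos2008, Prop. 3.1.7]
* T. Kennedy, E. H. Lieb, B. S. Shastry, Phys. Rev. Lett. 61 (1988) 2582 (structure factor, sum rule,
  long-range order from the zero mode). [cite: KLS1988PRL, p. 2582]
* T. Koma, H. Tasaki, J. Stat. Phys. 76 (1994) 745, §1 (order in symmetric finite-volume states is invisible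
  to one-point functions; long-range order as the diagnostic). [cite: KomaTasaki1994, §1]
-/

noncomputable section

namespace Literature.MathematicalPhysics.QuantumLattice

open Matrix Finset Literature.Probability.LatticeModels HubbardWave0
open scoped ComplexOrder ComplexConjugate

section Torus

variable (g : Site 2 → ℝ) (L : ℕ) [NeZero L]

/-! ### The objects -/

/-- **The Fejér box weight** `F_n(m) = n⁻⁴ |Σ_{u ∈ [0,n)²} χ_m(ū)|²` of the momentum label `m ∈ (ℤ/L)²`
(`ū = u mod L`): the normalised squared modulus of the two-dimensional Dirichlet sum over the box `[0,n)²`.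
[cite: Grafakos2008, Prop. 3.1.7] -/
def fejerBoxWeight (n : ℕ) (m : TorusSite 2 L) : ℝ :=
  ‖∑ u ∈ halfOpenBox 2 n, torusChar m (Torus.proj L u)‖ ^ 2 / (n : ℝ) ^ 4

/-- **The translation-averaged pair correlation at shift `z`**: `C̄_L(z) = L⁻² Re Σ_x ⟨P_x ψ, P_{x+z} ψ⟩`
(`P_x = localPair g L x`). [cite: KLS1988PRL, p. 2582] -/
def siteAvgPairCorr (ψ : Fock (Orb (FermionTorus 2 L))) (z : TorusSite 2 L) : ℝ :=
  (∑ x, star (localPair g L x *ᵥ ψ) ⬝ᵥ (localPair g L (x + z) *ᵥ ψ)).re / (L : ℝ) ^ 2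

/-- **The Fejér box average** `b_{L,n}(ψ) = n⁻⁴ Σ_{u,v ∈ [0,n)²} C̄_L(v̄ − ū)` of the translation-averaged pair
correlation over the displacements of a box of side `n`. [cite: Grafakos2008, Prop. 3.1.7] -/
def boxAvgPairCorr (ψ : Fock (Orb (FermionTorus 2 L))) (n : ℕ) : ℝ :=
  (∑ u ∈ halfOpenBox 2 n, ∑ v ∈ halfOpenBox 2 n,
      siteAvgPairCorr g L ψ (Torus.proj L v - Torus.proj L u)) / (n : ℝ) ^ 4

/-- **The torus diagonal** `s_L(ψ) = S_ψ(0)/L² = L⁻⁴ Re⟨ψ, Δ_g† Δ_g ψ⟩` (`pairStructureFactor_zero`): the pair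
long-range-order functional of a torus vector. [cite: KLS1988PRL, p. 2582] -/
def torusDiagonal (ψ : Fock (Orb (FermionTorus 2 L))) : ℝ :=
  pairStructureFactor g L ψ 0 / (L : ℝ) ^ 2

/-- **The small-momentum window tail** `T_ε(ψ)/L² = L⁻² Σ_{m ≠ 0, |q_m|² ≤ ε²} S_ψ(m)` (Kennedy–Lieb–Shastry
normalisation). [cite: KLS1988PRL, p. 2583] -/
def windowTail (ψ : Fock (Orb (FermionTorus 2 L))) (ε : ℝ) : ℝ :=
  (∑ m ∈ univ.filter (fun m : TorusSite 2 L => m ≠ 0 ∧ momentumNormSq L m ≤ ε ^ 2),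
      pairStructureFactor g L ψ m) / (L : ℝ) ^ 2

/-! ### The Fejér weight: elementary properties -/

/-- `F_n(m) ≥ 0`. [cite: Grafakos2008, Prop. 3.1.7] -/
theorem fejerBoxWeight_nonneg (n : ℕ) (m : TorusSite 2 L) : 0 ≤ fejerBoxWeight L n m :=
  div_nonneg (pow_nonneg (norm_nonneg _) 2) (pow_nonneg (Nat.cast_nonneg n) 4)

/-- `F_n(0) = 1` (`n ≥ 1`). [cite: Grafakos2008, Prop. 3.1.7] -/
theorem fejerBoxWeight_zero {n : ℕ} (hn : n ≠ 0) : fejerBoxWeight L n (0 : TorusSite 2 L) = 1 := by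
  have hn' : (n : ℝ) ^ 4 ≠ 0 := pow_ne_zero _ (Nat.cast_ne_zero.2 hn)
  simp only [fejerBoxWeight, torusChar_zero_left, sum_const, card_halfOpenBox, nsmul_eq_mul, mul_one]
  rw [div_eq_one_iff_eq hn']
  push_cast
  rw [Complex.norm_pow, Complex.norm_natCast]
  ring

/-- `F_n(m) ≤ 1`: the Dirichlet sum over `[0,n)²` has modulus at most `n²`. [cite: Grafakos2008, Prop. 3.1.7] -/
theorem fejerBoxWeight_le_one (n : ℕ) (m : TorusSite 2 L) : fejerBoxWeight L n m ≤ 1 := by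
  unfold fejerBoxWeight
  have h1 : ‖∑ u ∈ halfOpenBox 2 n, torusChar m (Torus.proj L u)‖ ≤ (n : ℝ) ^ 2 := by
    refine (norm_sum_le _ _).trans ?_
    simp only [norm_torusChar, sum_const, card_halfOpenBox, nsmul_eq_mul, mul_one]
    push_cast
    exact le_rfl
  have h2 : ‖∑ u ∈ halfOpenBox 2 n, torusChar m (Torus.proj L u)‖ ^ 2 ≤ (n : ℝ) ^ 4 := by
    calc ‖∑ u ∈ halfOpenBox 2 n, torusChar m (Torus.proj L u)‖ ^ 2 ≤ ((n : ℝ) ^ 2) ^ 2 :=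
          pow_le_pow_left₀ (norm_nonneg _) h1 2
      _ = (n : ℝ) ^ 4 := by ring
  exact div_le_one_of_le₀ h2 (pow_nonneg (Nat.cast_nonneg n) 4)

/-! ### (F1) The Fejér identity -/

/-- **The lattice Fejér identity**: `Σ_{u,v ∈ B} Re χ_m(v̄ − ū) = |Σ_{u ∈ B} χ_m(ū)|²` for every finite set of
sites `B` (`χ_m(v̄ − ū) = χ_m(v̄) conj χ_m(ū)`). [cite: Grafakos2008, Prop. 3.1.7] -/
theorem sum_sum_re_torusChar_sub_eq_norm_sq (m : TorusSite 2 L) (B : Finset (Site 2)) :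
    ∑ u ∈ B, ∑ v ∈ B, (torusChar m (Torus.proj L v - Torus.proj L u)).re =
      ‖∑ u ∈ B, torusChar m (Torus.proj L u)‖ ^ 2 := by
  have key : ∑ u ∈ B, ∑ v ∈ B, torusChar m (Torus.proj L v - Torus.proj L u) =
      conj (∑ u ∈ B, torusChar m (Torus.proj L u)) * ∑ v ∈ B, torusChar m (Torus.proj L v) := by
    rw [map_sum, Finset.sum_mul_sum]
    refine Finset.sum_congr rfl fun u _ => Finset.sum_congr rfl fun v _ => ?_
    rw [torusChar_sub_right, mul_comm]
  have h := congrArg Complex.re key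
  simp only [Complex.re_sum] at h
  rw [h, Complex.conj_mul', ← Complex.ofReal_pow, Complex.ofReal_re]

/-- **(F1) The Fejér identity for the pair structure factor**: for every torus vector `ψ` and every `n ≥ 1`,
`b_{L,n}(ψ) = L⁻² Σ_m F_n(m) · S_ψ(m)` — the box average of the translation-averaged pair correlation is the
Fejér-weighted average of the structure factor. [cite: Grafakos2008, Prop. 3.1.7] [cite: KLS1988PRL, p. 2582] -/
theorem boxAvgPairCorr_eq_sum_fejerBoxWeight_mul (ψ : Fock (Orb (FermionTorus 2 L))) {n : ℕ} (hn : n ≠ 0) :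
    boxAvgPairCorr g L ψ n = (∑ m, fejerBoxWeight L n m * pairStructureFactor g L ψ m) / (L : ℝ) ^ 2 := by
  have hn4 : (n : ℝ) ^ 4 ≠ 0 := pow_ne_zero _ (Nat.cast_ne_zero.2 hn)
  have hL2 : (L : ℝ) ^ 2 ≠ 0 := pow_ne_zero _ (Nat.cast_ne_zero.2 (NeZero.ne L))
  unfold boxAvgPairCorr siteAvgPairCorr fejerBoxWeight
  simp_rw [← sum_re_torusChar_mul_pairStructureFactor g L ψ, ← Finset.sum_div]
  rw [div_div, div_eq_div_iff (mul_ne_zero hL2 hn4) hL2]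
  -- swap the sums: `Σ_u Σ_v Σ_m c(u,v,m) S m = Σ_m S m Σ_u Σ_v c(u,v,m)`
  rw [Finset.sum_comm]
  simp_rw [Finset.sum_comm (s := halfOpenBox 2 n) (t := (univ : Finset (TorusSite 2 L)))]
  rw [Finset.sum_mul, Finset.sum_mul]
  refine Finset.sum_congr rfl fun m _ => ?_
  simp_rw [← Finset.sum_mul]
  rw [Finset.sum_comm, sum_sum_re_torusChar_sub_eq_norm_sq L m (halfOpenBox 2 n)]
  field_simp

/-! ### (F2) The torus diagonal is below every box average -/

/-- **(F2) Box average ≥ torus diagonal**: `s_L(ψ) ≤ b_{L,n}(ψ)` for every torus vector `ψ` and every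
`n ≥ 1` (drop the `m ≠ 0` terms of (F1): `F_n ≥ 0`, `S_ψ ≥ 0`, `F_n(0) = 1`) — Bochner positivity of the pair
structure factor; the Cauchy–Schwarz form is `pairFieldDensity_le_box_avgPairCorr_shape`.
[cite: KLS1988PRL, p. 2582] -/
theorem torusDiagonal_le_boxAvgPairCorr (ψ : Fock (Orb (FermionTorus 2 L))) {n : ℕ} (hn : n ≠ 0) :
    torusDiagonal g L ψ ≤ boxAvgPairCorr g L ψ n := by
  rw [boxAvgPairCorr_eq_sum_fejerBoxWeight_mul g L ψ hn, torusDiagonal]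
  refine div_le_div_of_nonneg_right ?_ (sq_nonneg _)
  calc pairStructureFactor g L ψ 0 = fejerBoxWeight L n 0 * pairStructureFactor g L ψ 0 := by
        rw [fejerBoxWeight_zero L hn, one_mul]
    _ ≤ ∑ m, fejerBoxWeight L n m * pairStructureFactor g L ψ m :=
        Finset.single_le_sum (f := fun m => fejerBoxWeight L n m * pairStructureFactor g L ψ m)
          (fun m _ => mul_nonneg (fejerBoxWeight_nonneg L n m) (pairStructureFactor_nonneg g L ψ m))
          (Finset.mem_univ _)


/-! ### (F3) The Fejér leakage bound and the window-tail decomposition -/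

/-- **One-dimensional Dirichlet sum**: `|Σ_{k<n} e^{ikθ}|² · (2 − 2cos θ) ≤ 4` (the geometric sum is
`(e^{inθ} − 1)/(e^{iθ} − 1)` and `|e^{iθ} − 1|² = 2 − 2cos θ`). [cite: Grafakos2008, Prop. 3.1.7] -/
theorem norm_sum_range_exp_pow_sq_mul_le (θ : ℝ) (n : ℕ) :
    ‖∑ k ∈ Finset.range n, Complex.exp ((θ : ℂ) * Complex.I) ^ k‖ ^ 2 * (2 - 2 * Real.cos θ) ≤ 4 := by
  set z : ℂ := Complex.exp ((θ : ℂ) * Complex.I) with hz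
  have hz1 : ‖z‖ = 1 := Complex.norm_exp_ofReal_mul_I θ
  have hnormsq : ‖z - 1‖ ^ 2 = 2 - 2 * Real.cos θ := by
    rw [← Complex.normSq_eq_norm_sq, Complex.normSq_apply, Complex.sub_re, Complex.sub_im, Complex.one_re,
      Complex.one_im, hz, Complex.exp_ofReal_mul_I_re, Complex.exp_ofReal_mul_I_im]
    nlinarith [Real.sin_sq_add_cos_sq θ]
  by_cases h1 : z = 1
  · rw [← hnormsq, h1, sub_self, norm_zero]
    norm_num
  · rw [geom_sum_eq h1, norm_div, div_pow, ← hnormsq,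
      div_mul_cancel₀ _ (pow_ne_zero 2 (norm_ne_zero_iff.2 (sub_ne_zero.2 h1)))]
    calc ‖z ^ n - 1‖ ^ 2 ≤ (‖z ^ n‖ + ‖(1 : ℂ)‖) ^ 2 :=
          pow_le_pow_left₀ (norm_nonneg _) (norm_sub_le _ _) 2
      _ = 4 := by rw [norm_pow, hz1, one_pow, norm_one]; norm_num

/-- **Jordan form of the Dirichlet bound**: `|Σ_{k<n} e^{ikθ}|² ≤ π²/θ²` for `0 < |θ| ≤ π`
(`2 − 2cos θ ≥ (4/π²)θ²`, `Real.cos_le_one_sub_mul_cos_sq`). [cite: Grafakos2008, Prop. 3.1.7] -/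
theorem norm_sum_range_exp_pow_sq_le {θ : ℝ} (hθ : |θ| ≤ Real.pi) (hθ0 : θ ≠ 0) (n : ℕ) :
    ‖∑ k ∈ Finset.range n, Complex.exp ((θ : ℂ) * Complex.I) ^ k‖ ^ 2 ≤ Real.pi ^ 2 / θ ^ 2 := by
  have hJ := Real.cos_le_one_sub_mul_cos_sq hθ
  have h4 := norm_sum_range_exp_pow_sq_mul_le θ n
  have hθ2 : 0 < θ ^ 2 := by positivity
  have hπ2 : 0 < Real.pi ^ 2 := by positivity
  rw [le_div_iff₀ hθ2]
  -- `‖Σ‖² θ² ≤ ‖Σ‖² (π²/4)(2 − 2cos θ) ≤ π²`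
  have hcos : 4 / Real.pi ^ 2 * θ ^ 2 ≤ 2 - 2 * Real.cos θ := by
    have e : 4 / Real.pi ^ 2 * θ ^ 2 = 2 * (2 / Real.pi ^ 2 * θ ^ 2) := by ring
    rw [e]
    linarith
  have hS : 0 ≤ ‖∑ k ∈ Finset.range n, Complex.exp ((θ : ℂ) * Complex.I) ^ k‖ ^ 2 := sq_nonneg _
  have := mul_le_mul_of_nonneg_left hcos hS
  have h' : ‖∑ k ∈ Finset.range n, Complex.exp ((θ : ℂ) * Complex.I) ^ k‖ ^ 2 * (4 / Real.pi ^ 2 * θ ^ 2) ≤ 4 :=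
    this.trans h4
  have e : ‖∑ k ∈ Finset.range n, Complex.exp ((θ : ℂ) * Complex.I) ^ k‖ ^ 2 * (4 / Real.pi ^ 2 * θ ^ 2) =
      (‖∑ k ∈ Finset.range n, Complex.exp ((θ : ℂ) * Complex.I) ^ k‖ ^ 2 * θ ^ 2) * (4 / Real.pi ^ 2) := by ring
  rw [e, ← le_div_iff₀ (by positivity)] at h'
  calc _ ≤ 4 / (4 / Real.pi ^ 2) := h'
    _ = Real.pi ^ 2 := by field_simp

/-- `|Σ_{k<n} e^{ikθ}| ≤ n` (each term has modulus one). [cite: Grafakos2008, Prop. 3.1.7] -/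
theorem norm_sum_range_exp_pow_le (θ : ℝ) (n : ℕ) :
    ‖∑ k ∈ Finset.range n, Complex.exp ((θ : ℂ) * Complex.I) ^ k‖ ≤ n := by
  refine (norm_sum_le _ _).trans ?_
  simp [Complex.norm_exp_ofReal_mul_I]

omit [NeZero L] in
/-- Reindexing `[0, n) ⊆ ℤ` by `range n`. [cite: FriedliVelenik2017, §3.2] -/
private theorem sum_Ico_int_eq_sum_range (n : ℕ) (f : ℤ → ℂ) :
    ∑ k ∈ Finset.Ico (0 : ℤ) n, f k = ∑ j ∈ Finset.range n, f j := by
  refine Finset.sum_nbij' (fun k => k.toNat) (fun j => (j : ℤ)) ?_ ?_ ?_ ?_ ?_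
  · intro k hk
    rw [Finset.mem_Ico] at hk
    rw [Finset.mem_range]
    omega
  · intro j hj
    rw [Finset.mem_range] at hj
    rw [Finset.mem_Ico]
    omega
  · intro k hk
    rw [Finset.mem_Ico] at hk
    omega
  · intro j _
    simp
  · intro k hk
    rw [Finset.mem_Ico] at hk
    congr 1
    omega

/-- The phase `θ_a = 2π·valMinAbs(a)/L ∈ (−π, π]` of a momentum component `a ∈ ℤ/L`. [cite: FriedliVelenik2017, §10.4] -/
private theorem abs_phase_le_pi (a : ZMod L) : |2 * Real.pi * (a.valMinAbs : ℝ) / L| ≤ Real.pi := by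
  have hL : (0 : ℝ) < L := by exact_mod_cast Nat.pos_of_ne_zero (NeZero.ne L)
  have hmem := ZMod.valMinAbs_mem_Ioc a
  rw [Set.mem_Ioc] at hmem
  have h1 : (-(L : ℝ)) < (a.valMinAbs : ℝ) * 2 := by exact_mod_cast hmem.1
  have h2 : (a.valMinAbs : ℝ) * 2 ≤ L := by exact_mod_cast hmem.2
  rw [abs_le]
  constructor
  · rw [le_div_iff₀ hL]; nlinarith [Real.pi_pos]
  · rw [div_le_iff₀ hL]; nlinarith [Real.pi_pos]

/-- **The one-dimensional character sum of the box is a geometric sum**: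
`Σ_{k ∈ [0,n)} e(a·k) = Σ_{j<n} (e^{iθ_a})^j`, `θ_a = 2π·valMinAbs(a)/L`. [cite: FriedliVelenik2017, §10.4] -/
theorem sum_stdAddChar_mul_intCast_eq_geom (a : ZMod L) (n : ℕ) :
    ∑ k ∈ Finset.Ico (0 : ℤ) n, (ZMod.stdAddChar (a * (k : ZMod L)) : ℂ) =
      ∑ j ∈ Finset.range n, Complex.exp (((2 * Real.pi * (a.valMinAbs : ℝ) / L : ℝ) : ℂ) * Complex.I) ^ j := by
  rw [sum_Ico_int_eq_sum_range]
  refine Finset.sum_congr rfl fun j _ => ?_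
  rw [← Complex.exp_nat_mul]
  conv_lhs => rw [← ZMod.coe_valMinAbs a]
  rw [show ((a.valMinAbs : ℤ) : ZMod L) * (((j : ℕ) : ℤ) : ZMod L) = ((a.valMinAbs * j : ℤ) : ZMod L) by push_cast; ring,
    ZMod.stdAddChar_coe]
  congr 1
  push_cast
  ring

/-- **The box character sum factorises** over the two coordinates:
`Σ_{u ∈ [0,n)²} χ_m(ū) = Π_i Σ_{k ∈ [0,n)} e(m_i k)`. [cite: Grafakos2008, Prop. 3.1.7] -/
theorem sum_torusChar_proj_halfOpenBox_eq_prod (m : TorusSite 2 L) (n : ℕ) :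
    ∑ u ∈ halfOpenBox 2 n, torusChar m (Torus.proj L u) =
      ∏ i : Fin 2, ∑ k ∈ Finset.Ico (0 : ℤ) n, (ZMod.stdAddChar (m i * (k : ZMod L)) : ℂ) := by
  rw [halfOpenBox, Finset.prod_univ_sum]
  refine Finset.sum_congr rfl fun u _ => ?_
  simp [torusChar, Torus.proj]

/-- **Fejér leakage bound**: for `n ≥ 1`, `ε > 0` and a momentum label off the window, `|q_m|² > ε²`,
`F_n(m) ≤ 2π²/(nε)²` — one coordinate phase has `θ_i² > ε²/2`, its Dirichlet factor is `≤ π²/θ_i²`, the other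
is `≤ n`. [cite: Grafakos2008, Prop. 3.1.7] -/
theorem fejerBoxWeight_le_of_lt_momentumNormSq {n : ℕ} (hn : n ≠ 0) {ε : ℝ} (hε : 0 < ε)
    {m : TorusSite 2 L} (hm : ε ^ 2 < momentumNormSq L m) :
    fejerBoxWeight L n m ≤ 2 * Real.pi ^ 2 / ((n : ℝ) * ε) ^ 2 := by
  have hn0 : (0 : ℝ) < n := by exact_mod_cast Nat.pos_of_ne_zero hn
  -- the two coordinate phases
  set θ : Fin 2 → ℝ := fun i => 2 * Real.pi * ((m i).valMinAbs : ℝ) / L with hθ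
  set G : Fin 2 → ℂ := fun i =>
    ∑ j ∈ Finset.range n, Complex.exp (((θ i : ℝ) : ℂ) * Complex.I) ^ j with hG
  have hsum : ∑ u ∈ halfOpenBox 2 n, torusChar m (Torus.proj L u) = G 0 * G 1 := by
    rw [sum_torusChar_proj_halfOpenBox_eq_prod, Fin.prod_univ_two, sum_stdAddChar_mul_intCast_eq_geom,
      sum_stdAddChar_mul_intCast_eq_geom]
  have hq : momentumNormSq L m = θ 0 ^ 2 + θ 1 ^ 2 := by
    rw [momentumNormSq_apply, Fin.sum_univ_two]
    simp only [hθ]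
    ring
  have hGle : ∀ i, ‖G i‖ ≤ n := fun i => norm_sum_range_exp_pow_le _ _
  have hGsq : ∀ i, ε ^ 2 / 2 < θ i ^ 2 → ‖G i‖ ^ 2 ≤ 2 * Real.pi ^ 2 / ε ^ 2 := by
    intro i hi
    have hθ0 : θ i ≠ 0 := by
      intro h0; rw [h0] at hi; nlinarith
    have h := norm_sum_range_exp_pow_sq_le (abs_phase_le_pi L (m i)) hθ0 n
    refine h.trans ?_
    rw [div_le_div_iff₀ (by positivity) (by positivity)]
    nlinarith [Real.pi_pos]
  -- which coordinate carries the momentum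
  have hcase : ε ^ 2 / 2 < θ 0 ^ 2 ∨ ε ^ 2 / 2 < θ 1 ^ 2 := by
    by_contra h
    push Not at h
    rw [hq] at hm
    linarith [h.1, h.2]
  have hprod : ‖G 0 * G 1‖ ^ 2 ≤ 2 * Real.pi ^ 2 / ε ^ 2 * (n : ℝ) ^ 2 := by
    rw [norm_mul, mul_pow]
    rcases hcase with h0 | h1
    · exact mul_le_mul (hGsq 0 h0) (pow_le_pow_left₀ (norm_nonneg _) (hGle 1) 2) (sq_nonneg _)
        (by positivity)
    · rw [mul_comm]
      exact mul_le_mul (hGsq 1 h1) (pow_le_pow_left₀ (norm_nonneg _) (hGle 0) 2) (sq_nonneg _)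
        (by positivity)
  unfold fejerBoxWeight
  rw [hsum, div_le_iff₀ (by positivity)]
  have e : 2 * Real.pi ^ 2 / ((n : ℝ) * ε) ^ 2 * (n : ℝ) ^ 4 = 2 * Real.pi ^ 2 / ε ^ 2 * (n : ℝ) ^ 2 := by
    rw [mul_pow, div_mul_eq_mul_div, div_mul_eq_mul_div, div_eq_div_iff (by positivity) (by positivity)]
    ring
  rw [e]
  exact hprod

/-- Pointwise form of the decomposition: `F_n(m)·S(m) ≤ [m = 0]·S(m) + [m ≠ 0, |q_m|² ≤ ε²]·S(m) +
(2π²/(nε)²)·S(m)`. [cite: KLS1988PRL, p. 2583] -/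
private theorem fejerBoxWeight_mul_le_split (ψ : Fock (Orb (FermionTorus 2 L))) {n : ℕ} (hn : n ≠ 0)
    {ε : ℝ} (hε : 0 < ε) (m : TorusSite 2 L) :
    fejerBoxWeight L n m * pairStructureFactor g L ψ m ≤
      (if m = 0 then pairStructureFactor g L ψ m else 0) +
        (if m ≠ 0 ∧ momentumNormSq L m ≤ ε ^ 2 then pairStructureFactor g L ψ m else 0) +
        2 * Real.pi ^ 2 / ((n : ℝ) * ε) ^ 2 * pairStructureFactor g L ψ m := by
  have hS := pairStructureFactor_nonneg g L ψ m
  have hF1 := fejerBoxWeight_le_one L n m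
  have hleak : 0 ≤ 2 * Real.pi ^ 2 / ((n : ℝ) * ε) ^ 2 * pairStructureFactor g L ψ m := by positivity
  have hFS : fejerBoxWeight L n m * pairStructureFactor g L ψ m ≤ pairStructureFactor g L ψ m :=
    mul_le_of_le_one_left hS hF1
  by_cases h0 : m = 0
  · rw [if_pos h0, if_neg (fun h => h.1 h0)]
    linarith
  · by_cases hw : momentumNormSq L m ≤ ε ^ 2
    · rw [if_neg h0, if_pos ⟨h0, hw⟩]
      linarith
    · rw [if_neg h0, if_neg (fun h => hw h.2)]
      have := mul_le_mul_of_nonneg_right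
        (fejerBoxWeight_le_of_lt_momentumNormSq L hn hε (lt_of_not_ge hw)) hS
      linarith

/-- **(F3) Torus diagonal ≥ box average − window tail − Fejér leakage**: for every torus vector `ψ`, every
`n ≥ 1` and every `ε > 0`,
`b_{L,n}(ψ) − T_ε(ψ)/L² − (2π²/(nε)²)·(Σ_m S_ψ(m))/L² ≤ s_L(ψ)`.
Together with (F2): the box average and the torus diagonal differ by at most the small-momentum window tail plus a
leakage term that is `O(n⁻²)` times the local pair density. [cite: KLS1988PRL, p. 2583] -/
theorem boxAvgPairCorr_sub_windowTail_sub_le_torusDiagonal (ψ : Fock (Orb (FermionTorus 2 L))) {n : ℕ}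
    (hn : n ≠ 0) {ε : ℝ} (hε : 0 < ε) :
    boxAvgPairCorr g L ψ n - windowTail g L ψ ε -
        2 * Real.pi ^ 2 / ((n : ℝ) * ε) ^ 2 * ((∑ m, pairStructureFactor g L ψ m) / (L : ℝ) ^ 2) ≤
      torusDiagonal g L ψ := by
  have hL2 : (0 : ℝ) < (L : ℝ) ^ 2 := by
    have : (0 : ℝ) < L := by exact_mod_cast Nat.pos_of_ne_zero (NeZero.ne L)
    positivity
  rw [boxAvgPairCorr_eq_sum_fejerBoxWeight_mul g L ψ hn, windowTail, torusDiagonal, Finset.sum_filter]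
  have key : ∑ m, fejerBoxWeight L n m * pairStructureFactor g L ψ m ≤
      pairStructureFactor g L ψ 0 +
        (∑ m, if m ≠ 0 ∧ momentumNormSq L m ≤ ε ^ 2 then pairStructureFactor g L ψ m else 0) +
        2 * Real.pi ^ 2 / ((n : ℝ) * ε) ^ 2 * ∑ m, pairStructureFactor g L ψ m := by
    calc ∑ m, fejerBoxWeight L n m * pairStructureFactor g L ψ m
        ≤ ∑ m : TorusSite 2 L, ((if m = 0 then pairStructureFactor g L ψ m else 0) +
            (if m ≠ 0 ∧ momentumNormSq L m ≤ ε ^ 2 then pairStructureFactor g L ψ m else 0) +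
            2 * Real.pi ^ 2 / ((n : ℝ) * ε) ^ 2 * pairStructureFactor g L ψ m) :=
          Finset.sum_le_sum fun m _ => fejerBoxWeight_mul_le_split g L ψ hn hε m
      _ = _ := by
          rw [Finset.sum_add_distrib, Finset.sum_add_distrib, Finset.sum_ite_eq' Finset.univ (0 : TorusSite 2 L),
            if_pos (Finset.mem_univ _), ← Finset.mul_sum]
  have := div_le_div_of_nonneg_right key hL2.le
  rw [add_div, add_div, mul_div_assoc] at this
  linarith

end Torus

end Literature.MathematicalPhysics.QuantumLattice
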